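import Summits.QuantumFields.YangMills.Theorems.BalabanUVNodesN11AllSmallEmptyExt
import Literature.MathematicalPhysics.QuantumFieldTheory.Balaban1983to89.B15Claim189LambdaPin

/-!
# DAG node N11 — THE STEP WEIGHT OF RECORD AT THE TOP CHILD `(Ω_{k+1}, Λ_{k+1}) = (𝕋, 𝕋)` IN CLOSED FORM: the fibre of n02-b∕def-T's index map (3.5)∕(3.20)
# over the all-small new pair is EXACTLY the labels `(P, Q, R, S) = (∅, ∅, ∅, S)`, and the resummed weight there is
# `w_k(s_top)(U, V′) = a(∅)(V′) · b(∅, ∅)(U, V′) · Σ_S ζ_{k+1}(∅, ∅, (∅, S))(U, V′)` — every (3.2) factor small at `V′`, every (3.3) factor small at `(U, V′)`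

HEADER — WORK-UNIT METADATA.  Cell `pub-ymgap`, YM-PLAN Track A (HUMAN RULING D-0062), seat `pub-ymgap-dag-n11-d` (g18; R134 fan-out seat N11 [B14], strategy s2),
route `BalabanUVNodes`, item K1⁹ = stmt-QuantumFields-27364 (helper lane, `--kind proof --supports 27364 --as helper`, count-neutral).  [III] = [Balaban1988Convergent]
(CMP **119** (1988) 243–285, §3 pp. 264–270).  Over n02-b∕def-T's `Node00.StepWeightsOfRecord` (labels `(P,Q,R,S)_{k+1}`, the index map `σOfRecord`, the label weights
`a·b·ζ`, the resummed step weights `wOfRecord`), this seat's g5 `Node00.StepWeightsAtNoExpansion` (the BOTTOM child `(∅, ∅)`: fibre and closed form; layer algebra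
`hullD_empty`, `cubesχ_empty`) and g8 `…N11AllSmallEmptyExt` (§1: over a term without large fields the label `(P, Q) = (∅, ∅)` has `Ω_{k+1} = 𝕋`; `fillD_univ`,
`cubes32_eq_univ_of_Zreg`, `qcubes_empty_eq_univ_of_Zreg`), and dag-n12's `B15Claim189LambdaPin.subset_hullD` (`X ⊆ X^{∼n}`).

WHY THIS FILE.  The -d lane (g10–g17) reduced the (O3′) clause of `PresentChildObligations` at a 𝐓-present expansion child `s′` to ONE one-fibre conditional-expectation
identity per (old branch, a.e. frozen retained configuration) — `…N11O3OfFibreCondExpAtRecord13` (p658744).  Its MAIN instance is the TOP CHILD of a history: the new pair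
`(Ω_{k+1}, Λ_{k+1}) = (𝕋, 𝕋)` (no new large-field region at all; by (2.1) it sits over the all-small history `Ω_j = Λ_j = 𝕋`, `j ≤ k`, [IV] (0.2)'s small-field term).
There NOTHING is frozen (`B_k(Ω^c_{k+1}) = ∅`), there is NO `Y`-sum (`Y ⊆ Ω_{k+1} ∩ Λ^c_{k+1} = ∅`) and NO kept fluctuation variable (`sA_k = B_k(Λ^c_{k+1} ∩ Ω_{k+1}) = ∅`): the
identity is [I] Thm 1 + [II]'s small-field step as ONE a.e. identity in the new field.  The OLD piece of that identity carries def-T's resummed step weight `w_k(s_top)(U, Ū)`;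
this file computes it in closed form — the complement of g5's bottom-child computation — so that the successor file can state the top-child identity letter by letter.

WHAT THIS FILE PROVES (0 `def`, 0 `sorry`, standard axioms; every run `p`, couplings `g`, level `k`, `A₁`, residual `ζ`; `N`-generic).
§1 THE FIBRE OVER THE TOP CHILD: `cubesχ_eq_empty_iff` · `fst_eq_empty_of_OmegaOfLabel_eq_univ` (the guard avoids `∪P` ⇒ `P = ∅`) · `LamPrev_eq_univ_of_OmegaOfLabel_eq_univ` ∕
   `Zreg_eq_empty_of_OmegaOfLabel_eq_univ` (only a term without large fields has a top child) · `snd_fst_eq_empty_of_OmegaOfLabel_eq_univ` ((3.5) removes two layers around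
   `Q̃` ⇒ `Q = ∅`) · `OmegaOfLabel_eq_univ_of_LambdaOfLabel_eq_univ` · `rfst_eq_empty_of_LambdaOfLabel_eq_univ` ((3.20) removes a layer around `R̃` ⇒ `R = ∅`) ·
   `LambdaOfLabel_empty_eq_univ` (`P = Q = R = ∅` over `Z_k = ∅` ⇒ `Λ_{k+1}(t) = 𝕋`) · `Seq_Λ_eq_univ_of_Ω_succ_eq_univ` ∕ `init_Λ_eq_univ_of_Ω_succ_eq_univ` ((2.1): a history with `Ω_{k+1} = 𝕋` has `Λ_k = 𝕋`) ·
   ★ `σOfRecord_eq_iff_of_top` — THE FIBRE IS `{(∅, ∅, (∅, S)) : S}` (the label `S_{k+1}` does not move the pair — n02-b §3's located simplification) · `sum_filter_top`.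
§2 THE CLOSED FORM: ★★ `wOfRecord_top_eq` (`w = a(∅)·b(∅,∅)·Σ_S ζ(∅,∅,(∅,S))`) · `aWeight_empty_eq_prod_univ` (`a(∅)(V′) = Π_{ALL χ_{k+1}-cubes} χ_{□′}(V′)`) ·
   `bWeight_empty_empty_eq_chiPrime_univ` (`b(∅,∅)(U,V′) = Π_{ALL cubes} 𝟙{(3.3)-small at (U,V′)}`) · ★★ `wOfRecord_top_eq_prod` (print's main term, all letters open) ·
   `chiSeqOfRecord_succ_top_eq_prod` ∕ `chiSeqOfRecord_succ_top_eq_aWeight_empty` (the FRONT FACTOR `χ_{k+1}(s_top)` IS `a(∅)`) · `prod_chiFactor_eq_one_of_chiSeq_top_ne_zero` · `wOfRecord_top_eq_zero_of_chiFactor_eq_zero` ∕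
   `wOfRecord_top_eq_zero_of_not_smallApproxFluct` (ONE (3.2)-large or (3.3)-large cube kills the top child — for EVERY residual `ζ`) ·
   `wOfRecord_top_eq_of_chiSeq_ne_zero` (on the χ_{k+1}-support the weight is `b(∅,∅)·Σ_S ζ`) · `abs_wOfRecord_top_le_one`.
§3 THE FIRST STEP `k = 0` (no large-field window ever: `Z_0 = ∅`): `σOfRecord_zero_eq_iff_of_top` · ★★ `wOfRecord_zero_top_eq_prod`.

HONEST FRAMING.  Finite resummation + layer algebra on the torus over def-T's ∕ n02-b's typed objects (count-neutral bookkeeping); nothing of Bałaban's estimates is asserted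
((3.6)–(3.9), (3.12)–(3.19), Thm 2 untouched); no sign or unity law of `ζ` is used except where displayed; the (3.2)∕(3.3) indicators are def-R's PINNED ones (their
non-vacuity passes through the classical (2.12) backgrounds and is not claimed).  N11 NOT discharged; K1⁹ NOT closed; no registered stub touched; counts unmoved
(typed 28∕28 · discharged 5∕27 · A 5∕28).  One finite `𝕋⁴_{L^K}` programme at fixed `ε = L^{−K}` — NOT ℝ⁴, NOT OS, NOT a mass gap, NOT Clay.  No `sorry`, `axiom`, `def`,
`instance`, `notation`.  Sources (SHAPE only): [III] (2.1) p.254, (2.3) p.255, (3.2)–(3.5) p.265, (3.16) p.268, (3.20)–(3.21) p.269, §3 p.267, (3.23)–(3.25) p.270;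
[IV] = [Balaban1989LargeFieldI] (0.2) p.176.
-/

noncomputable section

open scoped BigOperators

namespace Summit.QuantumFields.YangMills.Theorems.BalabanUVNodesN11TopChildStepWeight

open Literature.MathematicalPhysics.QuantumFieldTheory.Balaban1983to89 T4Continuum Node00 B14.Eq218Concrete B14.Sect3Decomp
open B15Claim189LambdaPin (subset_hullD)
open BalabanUVNodesN11AllSmallEmptyExt (fillD_univ Zreg_eq_empty_of_Λ cubes32_eq_univ_of_Zreg qcubes_empty_eq_univ_of_Zreg OmegaOfLabel_empty_empty_eq_univ)

variable {F : T4Family} {N : ℕ} [NeZero N]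

/-! ## §1. The fibre of the index map (3.5)∕(3.20) over the top child -/

section Fibre

variable (F) (ν : Stage7Numerics) (M : ℕ) (p : B12.RunParams) (g : ℕ → ℝ) (k : ℕ)

omit [NeZero N] in
/-- A union of χ_{k+1}-cubes is empty iff the index set is (every cube of the torus partition is inhabited). [cite: Balaban1988Convergent, (3.2) p.265 (bookkeeping)] -/
theorem cubesχ_eq_empty_iff (X : Finset (Iχ F ν p g k)) : cubesχ F ν p g k X = ∅ ↔ X = ∅ := by
  refine ⟨fun h => ?_, fun h => by rw [h, cubesχ_empty]⟩
  by_contra hX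
  obtain ⟨c, hc⟩ := Finset.nonempty_iff_ne_empty.2 hX
  obtain ⟨x, hx⟩ := cubeEnl_zero_nonempty (F.P p.K) (sideχ F ν p g k) c.2
  have hxX : x ∈ cubesχ F ν p g k X := by
    simp only [cubesχ, Set.mem_iUnion]
    exact ⟨c, hc, hx⟩
  rw [h] at hxX
  exact hxX

omit [NeZero N] in
/-- **`Ω_{k+1}(t) = 𝕋 ⇒ P_{k+1} = ∅`**: `Ω_{k+1}(t)` lies in the typing guard, which avoids `∪P_{k+1}`. [cite: Balaban1988Convergent, (3.5) p.265] -/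
theorem fst_eq_empty_of_OmegaOfLabel_eq_univ (s : SeqOfRecord F ν M g p.K k) (t : LbOfRecord F ν p g k)
    (h : OmegaOfLabel F ν M p g k s t = Set.univ) : t.1 = ∅ := by
  have hg : guardΩ F ν M p g k s t.1 = Set.univ := Set.eq_univ_of_univ_subset (h ▸ OmegaOfLabel_subset_guard F ν M p g k s t)
  have hc : (cubesχ F ν p g k t.1)ᶜ = Set.univ := Set.eq_univ_of_univ_subset (hg ▸ Set.inter_subset_right)
  rw [Set.compl_univ_iff] at hc
  exact (cubesχ_eq_empty_iff F ν p g k t.1).1 hc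

omit [NeZero N] in
/-- `Ω_{k+1}(t) = 𝕋 ⇒` the admissibility window `Λ_k` (no condition at `k = 0`) is the whole torus. [cite: Balaban1988Convergent, (2.1) p.254, (3.5) p.265] -/
theorem LamPrev_eq_univ_of_OmegaOfLabel_eq_univ (s : SeqOfRecord F ν M g p.K k) (t : LbOfRecord F ν p g k)
    (h : OmegaOfLabel F ν M p g k s t = Set.univ) : LamPrev F ν M p g k s = Set.univ := by
  have hg : guardΩ F ν M p g k s t.1 = Set.univ := Set.eq_univ_of_univ_subset (h ▸ OmegaOfLabel_subset_guard F ν M p g k s t)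
  exact Set.eq_univ_of_univ_subset (hg ▸ (Set.inter_subset_left.trans Set.inter_subset_left))

omit [NeZero N] in
/-- **ONLY A TERM WITHOUT LARGE FIELDS HAS A TOP CHILD**: `Ω_{k+1}(t) = 𝕋 ⇒ Z_k = ∅` (the guard lies in the (3.2) window `(Z̃_k^{∼4})ᶜ`, and `Z_k ⊆ Z̃_k^{∼4}`).
[cite: Balaban1988Convergent, (2.3) p.255, (3.2) p.265, p.264–265] -/
theorem Zreg_eq_empty_of_OmegaOfLabel_eq_univ (hD : 0 < sideD F ν M p g k) (s : SeqOfRecord F ν M g p.K k) (t : LbOfRecord F ν p g k)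
    (h : OmegaOfLabel F ν M p g k s t = Set.univ) : Zreg F ν M p g k s = ∅ := by
  have hg : guardΩ F ν M p g k s t.1 = Set.univ := Set.eq_univ_of_univ_subset (h ▸ OmegaOfLabel_subset_guard F ν M p g k s t)
  have hW : W32 F ν M p g k s = Set.univ := Set.eq_univ_of_univ_subset (hg ▸ (Set.inter_subset_left.trans Set.inter_subset_right))
  have hZ4 : Ztilde4 F ν M p g k s = ∅ := by rw [← Set.compl_univ_iff, ← hW]; rfl
  have h0 : hullD (F.P p.K) (sideD F ν M p g k) 0 (Zreg F ν M p g k s) = ∅ :=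
    Set.eq_empty_of_subset_empty (hZ4 ▸ subset_hullD hD 4 _)
  exact Set.eq_empty_of_subset_empty (h0 ▸ subset_hullD hD 0 _)

omit [NeZero N] in
/-- **`Ω_{k+1}(t) = 𝕋 ⇒ Q_{k+1} = ∅`**: (3.5) removes two layers of 𝐃_{k+1}-cubes around `Q̃_{k+1} ⊇ ∪Q_{k+1}`. [cite: Balaban1988Convergent, (3.5) p.265] -/
theorem snd_fst_eq_empty_of_OmegaOfLabel_eq_univ (hD : 0 < sideD F ν M p g k) (s : SeqOfRecord F ν M g p.K k) (t : LbOfRecord F ν p g k)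
    (h : OmegaOfLabel F ν M p g k s t = Set.univ) : t.2.1 = ∅ := by
  have h1 : Omega0 F ν M p g k s t.1 t.2.1 ∩ guardΩ F ν M p g k s t.1 = Set.univ :=
    Set.eq_univ_of_univ_subset (h ▸ fillD_subset (F.P p.K) (sideD F ν M p g k) _)
  have hO : Omega0 F ν M p g k s t.1 t.2.1 = Set.univ := Set.eq_univ_of_univ_subset (h1 ▸ Set.inter_subset_left)
  have h2 : hullD (F.P p.K) (sideD F ν M p g k) 2
      (hullD (F.P p.K) (sideD F ν M p g k) 0 (cubesχ F ν p g k t.2.1) ∪ hullD (F.P p.K) (sideD F ν M p g k) 0 (Bdom F ν M p g k s t.1)ᶜ) = ∅ := by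
    rw [← Set.compl_univ_iff, ← hO]; rfl
  have h3 : hullD (F.P p.K) (sideD F ν M p g k) 0 (cubesχ F ν p g k t.2.1) = ∅ :=
    Set.eq_empty_of_subset_empty ((Set.subset_union_left.trans (subset_hullD hD 2 _)).trans h2.subset)
  have h4 : cubesχ F ν p g k t.2.1 = ∅ := Set.eq_empty_of_subset_empty (h3 ▸ subset_hullD hD 0 _)
  exact (cubesχ_eq_empty_iff F ν p g k t.2.1).1 h4

omit [NeZero N] in
/-- `Λ_{k+1}(t) = 𝕋 ⇒ Ω_{k+1}(t) = 𝕋` ((2.1): `Λ_{k+1} ⊆ Ω_{k+1}`). [cite: Balaban1988Convergent, (2.1) p.254] -/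
theorem OmegaOfLabel_eq_univ_of_LambdaOfLabel_eq_univ (s : SeqOfRecord F ν M g p.K k) (t : LbOfRecord F ν p g k)
    (h : LambdaOfLabel F ν M p g k s t = Set.univ) : OmegaOfLabel F ν M p g k s t = Set.univ :=
  Set.eq_univ_of_univ_subset (h ▸ LambdaOfLabel_subset F ν M p g k s t)

omit [NeZero N] in
/-- **`Λ_{k+1}(t) = 𝕋 ⇒ R_{k+1} = ∅`**: (3.20) removes a layer of 𝐃_{k+1}-cubes around `R̃_{k+1} ⊇ ∪R_{k+1}`. [cite: Balaban1988Convergent, (3.20) p.269] -/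
theorem rfst_eq_empty_of_LambdaOfLabel_eq_univ (hD : 0 < sideD F ν M p g k) (s : SeqOfRecord F ν M g p.K k) (t : LbOfRecord F ν p g k)
    (h : LambdaOfLabel F ν M p g k s t = Set.univ) : t.2.2.1 = ∅ := by
  have h1 : Lambda0 F ν M p g k s t ∩ OmegaOfLabel F ν M p g k s t = Set.univ :=
    Set.eq_univ_of_univ_subset (h ▸ fillD_subset (F.P p.K) (sideD F ν M p g k) _)
  have hL : Lambda0 F ν M p g k s t = Set.univ := Set.eq_univ_of_univ_subset (h1 ▸ Set.inter_subset_left)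
  have h2 : hullD (F.P p.K) (sideD F ν M p g k) 1
      (hullD (F.P p.K) (sideD F ν M p g k) 0 (OmegaOfLabel F ν M p g k s t)ᶜ ∪ hullD (F.P p.K) (sideD F ν M p g k) 0 (cubesχ F ν p g k t.2.2.1)) = ∅ := by
    rw [← Set.compl_univ_iff, ← hL]; rfl
  have h3 : hullD (F.P p.K) (sideD F ν M p g k) 0 (cubesχ F ν p g k t.2.2.1) = ∅ :=
    Set.eq_empty_of_subset_empty ((Set.subset_union_right.trans (subset_hullD hD 1 _)).trans h2.subset)
  have h4 : cubesχ F ν p g k t.2.2.1 = ∅ := Set.eq_empty_of_subset_empty (h3 ▸ subset_hullD hD 0 _)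
  exact (cubesχ_eq_empty_iff F ν p g k t.2.2.1).1 h4

omit [NeZero N] in
/-- **OVER A TERM WITHOUT LARGE FIELDS THE LABEL `(∅, ∅, (∅, S))` HAS `Λ_{k+1} = 𝕋`** (whatever `S`): `Ω_{k+1} = 𝕋` by g8's `OmegaOfLabel_empty_empty_eq_univ`, (3.20) surrounds
`(𝕋ᶜ)^∼ ∪ ∅̃ = ∅`, and filling `𝕋` with 𝐃_{k+1}-cubes keeps `𝕋`. [cite: Balaban1988Convergent, (3.20) p.269, (2.1) p.254] -/
theorem LambdaOfLabel_empty_eq_univ (hD : 0 < sideD F ν M p g k) (s : SeqOfRecord F ν M g p.K k) (hΛ : 1 ≤ k → s.Λ k = Set.univ)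
    (S : Finset (Iχ F ν p g k)) : LambdaOfLabel F ν M p g k s (∅, ∅, (∅, S)) = Set.univ := by
  have hΩ : OmegaOfLabel F ν M p g k s (∅, ∅, (∅, S)) = Set.univ := OmegaOfLabel_empty_empty_eq_univ F ν M p g k hD s hΛ (∅, S)
  have hL0 : Lambda0 F ν M p g k s (∅, ∅, (∅, S)) = Set.univ := by
    change (hullD (F.P p.K) (sideD F ν M p g k) 1
      (hullD (F.P p.K) (sideD F ν M p g k) 0 (OmegaOfLabel F ν M p g k s (∅, ∅, (∅, S)))ᶜ ∪
        hullD (F.P p.K) (sideD F ν M p g k) 0 (cubesχ F ν p g k ∅)))ᶜ = Set.univ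
    rw [hΩ, Set.compl_univ, cubesχ_empty, hullD_empty, Set.empty_union, hullD_empty, Set.compl_empty]
  rw [LambdaOfLabel, hL0, hΩ, Set.univ_inter, fillD_univ _ _ hD]

omit [NeZero N] in
/-- **(2.1): A HISTORY WITH `Ω_{k+1} = 𝕋` HAS `Λ_k = 𝕋`** (`Ω_{k+1} ⊆ Λ_k` for `k ≥ 1`) — recursively it is the all-small history. [cite: Balaban1988Convergent, (2.1) p.254] -/
theorem Seq_Λ_eq_univ_of_Ω_succ_eq_univ (s' : SeqOfRecord F ν M g p.K (k + 1)) (hΩ : s'.Ω (k + 1) = Set.univ) (hk : 1 ≤ k) :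
    s'.Λ k = Set.univ :=
  Set.eq_univ_of_univ_subset (hΩ ▸ s'.chain.Ω_succ_subset k hk (Nat.lt_succ_self k))

omit [NeZero N] in
/-- The `init` of a history with `Ω_{k+1} = 𝕋` has `Λ_k = 𝕋` (for `k ≥ 1`), hence NO large-field region `Z_k`. [cite: Balaban1988Convergent, (2.1) p.254, (2.3) p.255] -/
theorem init_Λ_eq_univ_of_Ω_succ_eq_univ (s' : SeqOfRecord F ν M g p.K (k + 1)) (hΩ : s'.Ω (k + 1) = Set.univ) :
    1 ≤ k → s'.init.Λ k = Set.univ := fun hk => by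
  rw [Seq.init_Λ s' hk le_rfl]
  exact Seq_Λ_eq_univ_of_Ω_succ_eq_univ F ν M p g k s' hΩ hk

omit [NeZero N] in
/-- ★ **THE FIBRE OF THE INDEX MAP OVER THE TOP CHILD**: for `s′` with `init s′ = s` and `(Ω_{k+1}, Λ_{k+1})(s′) = (𝕋, 𝕋)`, a label `t = (P, Q, R, S)_{k+1}` is mapped to `s′`
by (3.5)∕(3.20) iff `P = Q = R = ∅` — the new large-fluctuation label `S_{k+1}` is free (it does not move the pair in the tree's rendering; n02-b §3's located simplification).
[cite: Balaban1988Convergent, (3.2)–(3.5) p.265, (3.16) p.268, (3.20)–(3.21) p.269, (2.1) p.254] -/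
theorem σOfRecord_eq_iff_of_top (hD : 0 < sideD F ν M p g k) (s : SeqOfRecord F ν M g p.K k) (s' : SeqOfRecord F ν M g p.K (k + 1))
    (hs : s'.init = s) (hΩ : s'.Ω (k + 1) = Set.univ) (hΛ : s'.Λ (k + 1) = Set.univ) (t : LbOfRecord F ν p g k) :
    σOfRecord F ν M p g k s t = s' ↔ t.1 = ∅ ∧ t.2.1 = ∅ ∧ t.2.2.1 = ∅ := by
  constructor
  · intro h
    have hL : LambdaOfLabel F ν M p g k s t = Set.univ := by rw [← σOfRecord_Λ_succ F ν M p g k s t, h, hΛ]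
    have hO : OmegaOfLabel F ν M p g k s t = Set.univ := OmegaOfLabel_eq_univ_of_LambdaOfLabel_eq_univ F ν M p g k s t hL
    exact ⟨fst_eq_empty_of_OmegaOfLabel_eq_univ F ν M p g k s t hO, snd_fst_eq_empty_of_OmegaOfLabel_eq_univ F ν M p g k hD s t hO,
      rfst_eq_empty_of_LambdaOfLabel_eq_univ F ν M p g k hD s t hL⟩
  · rintro ⟨hP, hQ, hR⟩
    obtain ⟨Pl, Ql, Rl, Sl⟩ := t
    simp only at hP hQ hR
    subst hP; subst hQ; subst hR
    have hΛk : 1 ≤ k → s.Λ k = Set.univ := fun hk => by rw [← hs]; exact init_Λ_eq_univ_of_Ω_succ_eq_univ F ν M p g k s' hΩ hk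
    have hO : OmegaOfLabel F ν M p g k s (∅, ∅, (∅, Sl)) = Set.univ := OmegaOfLabel_empty_empty_eq_univ F ν M p g k hD s hΛk (∅, Sl)
    have hL : LambdaOfLabel F ν M p g k s (∅, ∅, (∅, Sl)) = Set.univ := LambdaOfLabel_empty_eq_univ F ν M p g k hD s hΛk Sl
    subst hs
    apply Seq.ext'
    · funext j
      by_cases hj : 1 ≤ j ∧ j ≤ k + 1
      · rcases Nat.lt_or_eq_of_le hj.2 with hlt | rfl
        · have hjk : j ≤ k := Nat.le_of_lt_succ hlt
          rw [σOfRecord, Seq.snoc_Ω_of_le _ _ hj.1 hjk, Seq.init_Ω _ hj.1 hjk]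
        · rw [σOfRecord_Ω_succ, hO, hΩ]
      · rw [(σOfRecord F ν M p g k s'.init (∅, ∅, (∅, Sl))).Ω_off j hj, s'.Ω_off j hj]
    · funext j
      by_cases hj : 1 ≤ j ∧ j ≤ k + 1
      · rcases Nat.lt_or_eq_of_le hj.2 with hlt | rfl
        · have hjk : j ≤ k := Nat.le_of_lt_succ hlt
          rw [σOfRecord, Seq.snoc_Λ_of_le _ _ hj.1 hjk, Seq.init_Λ _ hj.1 hjk]
        · rw [σOfRecord_Λ_succ, hL, hΛ]
      · rw [(σOfRecord F ν M p g k s'.init (∅, ∅, (∅, Sl))).Λ_off j hj, s'.Λ_off j hj]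

omit [NeZero N] in
/-- Summing over the fibre `{(∅, ∅, (∅, S)) : S}` is summing over `S`. [cite: Balaban1988Convergent, (3.21) p.269 (bookkeeping)] -/
theorem sum_filter_top [DecidablePred (fun t : LbOfRecord F ν p g k => t.1 = ∅ ∧ t.2.1 = ∅ ∧ t.2.2.1 = ∅)] (f : LbOfRecord F ν p g k → ℝ) :
    ∑ t ∈ Finset.univ.filter (fun t : LbOfRecord F ν p g k => t.1 = ∅ ∧ t.2.1 = ∅ ∧ t.2.2.1 = ∅), f t =
      ∑ S : Finset (Iχ F ν p g k), f (∅, ∅, (∅, S)) := by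
  refine Finset.sum_nbij' (fun t => t.2.2.2) (fun S => ((∅ : Finset (Iχ F ν p g k)), (∅ : Finset (Iχ F ν p g k)), ((∅ : Finset (Iχ F ν p g k)), S)))
    (fun _ _ => Finset.mem_univ _) (fun S _ => by simp) (fun t ht => ?_) (fun _ _ => rfl) (fun t ht => ?_) <;>
  · obtain ⟨Pl, Ql, Rl, Sl⟩ := t
    simp only [Finset.mem_filter, Finset.mem_univ, true_and] at ht
    obtain ⟨rfl, rfl, rfl⟩ := ht
    rfl

end Fibre

/-! ## §2. The closed form of the resummed step weight at the top child -/

section ClosedForm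

variable (F N) (ν : Stage7Numerics) (M : ℕ) (A₁ : ℝ) (p : B12.RunParams) (g : ℕ → ℝ) (k : ℕ)

/-- ★★ **THE STEP WEIGHT OF RECORD AT THE TOP CHILD**: at a history `s′` with `(Ω_{k+1}, Λ_{k+1})(s′) = (𝕋, 𝕋)`,
`w_k(s′)(U, V′) = a(∅)(V′) · b(∅, ∅)(U, V′) · Σ_S ζ_{k+1}(∅, ∅, (∅, S))(U, V′)` — the (3.2) label weight of `P = ∅`, the (3.3) label weight of `(P, Q) = (∅, ∅)`, and the residual
fluctuation factor's `R = ∅` marginal over the free label `S`. [cite: Balaban1988Convergent, (3.2)–(3.5) p.265, (3.16) p.268, (3.20)–(3.21) p.269, §3 p.267, p.270] -/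
theorem wOfRecord_top_eq (ζ : ZetaOfRecord F N ν M) (hD : 0 < sideD F ν M p g k) (s' : SeqOfRecord F ν M g p.K (k + 1))
    (hΩ : s'.Ω (k + 1) = Set.univ) (hΛ : s'.Λ (k + 1) = Set.univ) (U : GaugeField (F.P p.K) k (SU N)) (V' : GaugeField (F.P p.K) (k + 1) (SU N)) :
    wOfRecord F N ν M A₁ ζ p g k s' U V' =
      aWeight F N ν M p g k s'.init ∅ V' * bWeight F N ν M p g k A₁ s'.init ∅ ∅ U V' * ∑ S : Finset (Iχ F ν p g k), ζ p g k s'.init ∅ ∅ (∅, S) U V' := by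
  classical
  rw [wOfRecord_apply, resumWeights]
  have hfilter : Finset.univ.filter (fun t : LbOfRecord F ν p g k => σOfRecord F ν M p g k s'.init t = s') =
      Finset.univ.filter (fun t : LbOfRecord F ν p g k => t.1 = ∅ ∧ t.2.1 = ∅ ∧ t.2.2.1 = ∅) := by
    ext t
    simp only [Finset.mem_filter, Finset.mem_univ, true_and]
    exact σOfRecord_eq_iff_of_top F ν M p g k hD s'.init s' rfl hΩ hΛ t
  rw [hfilter, sum_filter_top F ν p g k, Finset.mul_sum]
  exact Finset.sum_congr rfl fun S _ => by rw [ωOfRecord]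

/-- **`a(∅)(V′) = Π_{ALL χ_{k+1}-cubes} χ_{□′}(V′)`** over a term without large fields (`cubes32 = univ`, `χᶜ_{k+1}(∅) = 1`): every (3.2) factor of the step is (3.2)-SMALL at `V′`.
[cite: Balaban1988Convergent, (3.2) p.265] -/
theorem aWeight_empty_eq_prod_univ (s : SeqOfRecord F ν M g p.K k) (hZ : Zreg F ν M p g k s = ∅) (V' : GaugeField (F.P p.K) (k + 1) (SU N)) :
    aWeight F N ν M p g k s ∅ V' = ∏ c : Iχ F ν p g k, chiFactor F N ν p g k c V' := by
  rw [aWeight, if_pos (Finset.empty_subset _), chiNext_sect3DataOfRecord, Finset.sdiff_empty, cubes32_eq_univ_of_Zreg F ν M p g k s hZ]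
  have h1 : chiNextc (sect3DataOfRecord F N ν M p g k s) (epsOfRecord ν g (k + 1)) (∅ : Finset (Iχ F ν p g k)) V' = 1 := by
    unfold chiNextc; exact Finset.prod_empty
  rw [h1, mul_one]

/-- **`b(∅, ∅)(U, V′) = χ′_k(ALL cubes)(U, V′) = Π_{ALL χ_{k+1}-cubes} 𝟙{(3.3)-small at (U, V′)}`** over a term without large fields (`qcubes ∅ = univ`, `χ′ᶜ_k(∅) = 1`): every cube of the
step is (3.3)-SMALL, i.e. `|U(b)·(V^{(k)}_{□′}(b))⁻¹ − 1| < 2δ_k` on `(□′^{∼2})^{(k)*}`. [cite: Balaban1988Convergent, (3.3)–(3.4) p.265] -/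
theorem bWeight_empty_empty_eq_chiPrime_univ (s : SeqOfRecord F ν M g p.K k) (hZ : Zreg F ν M p g k s = ∅)
    (U : GaugeField (F.P p.K) k (SU N)) (V' : GaugeField (F.P p.K) (k + 1) (SU N)) :
    bWeight F N ν M p g k A₁ s ∅ ∅ U V' =
      chiPrime (sect3DataOfRecord F N ν M p g k s) (avOfRecord F N p.K) (2 * deltaOfRecord ν g k A₁) (Finset.univ : Finset (Iχ F ν p g k)) U V' := by
  classical
  rw [bWeight, if_pos (Finset.empty_subset _), Finset.sdiff_empty, qcubes_empty_eq_univ_of_Zreg F ν M p g k s hZ]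
  have h1 : chiPrimec (sect3DataOfRecord F N ν M p g k s) (avOfRecord F N p.K) (2 * deltaOfRecord ν g k A₁) (∅ : Finset (Iχ F ν p g k)) U V' = 1 := by
    unfold chiPrimec; exact Finset.prod_empty
  rw [h1, mul_one]

/-- ★★ **PRINT'S MAIN TERM, ALL LETTERS OPEN**: at a history `s′` with `(Ω_{k+1}, Λ_{k+1})(s′) = (𝕋, 𝕋)`,
`w_k(s′)(U, V′) = (Π_{□′} χ_{□′}(V′)) · χ′_k(ALL cubes)(U, V′) · Σ_S ζ_{k+1}(∅, ∅, (∅, S))(U, V′)` — every (3.2) factor small at the new field, every (3.3) factor small at `(U, V′)`, times the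
residual's `R = ∅` marginal. [cite: Balaban1988Convergent, (3.2)–(3.5) p.265, (3.16) p.268, (3.20)–(3.21) p.269, §3 p.267] -/
theorem wOfRecord_top_eq_prod (ζ : ZetaOfRecord F N ν M) (hD : 0 < sideD F ν M p g k) (s' : SeqOfRecord F ν M g p.K (k + 1))
    (hΩ : s'.Ω (k + 1) = Set.univ) (hΛ : s'.Λ (k + 1) = Set.univ) (U : GaugeField (F.P p.K) k (SU N)) (V' : GaugeField (F.P p.K) (k + 1) (SU N)) :
    wOfRecord F N ν M A₁ ζ p g k s' U V' =
      (∏ c : Iχ F ν p g k, chiFactor F N ν p g k c V') *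
        chiPrime (sect3DataOfRecord F N ν M p g k s'.init) (avOfRecord F N p.K) (2 * deltaOfRecord ν g k A₁) (Finset.univ : Finset (Iχ F ν p g k)) U V' *
          ∑ S : Finset (Iχ F ν p g k), ζ p g k s'.init ∅ ∅ (∅, S) U V' := by
  have hZ : Zreg F ν M p g k s'.init = ∅ := Zreg_eq_empty_of_Λ F ν M p g k s'.init (init_Λ_eq_univ_of_Ω_succ_eq_univ F ν M p g k s' hΩ)
  rw [wOfRecord_top_eq F N ν M A₁ p g k ζ hD s' hΩ hΛ U V', aWeight_empty_eq_prod_univ F N ν M p g k s'.init hZ V',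
    bWeight_empty_empty_eq_chiPrime_univ F N ν M A₁ p g k s'.init hZ U V']

/-- **THE FRONT FACTOR OF THE TOP CHILD IS THE PRODUCT OF ALL (3.2) FACTORS**: `χ_{k+1}(s′)(V′) = Π_{□′} χ_{□′}(V′)` (every χ_{k+1}-cube lies inside `Ω_{k+1}(s′) = 𝕋`).
[cite: Balaban1988Convergent, (2.17)–(2.18) p.257, p.267] -/
theorem chiSeqOfRecord_succ_top_eq_prod (s' : SeqOfRecord F ν M g p.K (k + 1)) (hΩ : s'.Ω (k + 1) = Set.univ) (V' : GaugeField (F.P p.K) (k + 1) (SU N)) :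
    chiSeqOfRecord F N ν M g p.K (k + 1) s' V' = ∏ c : Iχ F ν p g k, chiFactor F N ν p g k c V' := by
  classical
  -- `χ_{k+1}(s′)` reads `Ω_{k+1}(s′) = 𝕋` only, and every χ_{k+1}-cube lies inside `𝕋`
  rw [chiSeqOfRecord, chi218_apply, hΩ]
  have hall : cubesIn (cubeχ F ν p g k) (Set.univ : Set (Site (F.P p.K) 0)) = Finset.univ := by
    ext c; simp only [mem_cubesIn, Set.subset_univ, Finset.mem_univ]
  change (∏ c ∈ cubesIn (cubeχ F ν p g k) (Set.univ : Set (Site (F.P p.K) 0)), chiFactor F N ν p g k c V') = _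
  rw [hall]

/-- **… AND IT IS `a(∅)(V′)`** — so the (O3′) support clause `χ_{k+1}(s′)(V′) ≠ 0` at the top child says exactly «every χ_{k+1}-cube (3.2)-small at `V′`».
[cite: Balaban1988Convergent, (3.2) p.265, p.267] -/
theorem chiSeqOfRecord_succ_top_eq_aWeight_empty (s' : SeqOfRecord F ν M g p.K (k + 1)) (hΩ : s'.Ω (k + 1) = Set.univ) (V' : GaugeField (F.P p.K) (k + 1) (SU N)) :
    chiSeqOfRecord F N ν M g p.K (k + 1) s' V' = aWeight F N ν M p g k s'.init ∅ V' := by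
  rw [chiSeqOfRecord_succ_top_eq_prod F N ν M p g k s' hΩ V',
    aWeight_empty_eq_prod_univ F N ν M p g k s'.init (Zreg_eq_empty_of_Λ F ν M p g k s'.init (init_Λ_eq_univ_of_Ω_succ_eq_univ F ν M p g k s' hΩ)) V']

/-- The product of all (3.2) factors is `{0,1}`-valued: it is idempotent. [cite: Balaban1988Convergent, (3.2) p.265 (bookkeeping)] -/
theorem prod_chiFactor_mul_self (V' : GaugeField (F.P p.K) (k + 1) (SU N)) :
    (∏ c : Iχ F ν p g k, chiFactor F N ν p g k c V') * ∏ c : Iχ F ν p g k, chiFactor F N ν p g k c V' = ∏ c : Iχ F ν p g k, chiFactor F N ν p g k c V' := by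
  rw [← Finset.prod_mul_distrib]
  exact Finset.prod_congr rfl fun c _ => chiFactor_mul_self F N ν p g k c V'

/-- **ON ITS SUPPORT THE FRONT FACTOR OF THE TOP CHILD IS `1`**: `χ_{k+1}(s′)(V′) ≠ 0 ⇒ Π_{□′} χ_{□′}(V′) = 1` (a `{0,1}`-valued product).
[cite: Balaban1988Convergent, (3.2) p.265, p.267 (bookkeeping)] -/
theorem prod_chiFactor_eq_one_of_chiSeq_top_ne_zero (s' : SeqOfRecord F ν M g p.K (k + 1)) (hΩ : s'.Ω (k + 1) = Set.univ)
    (V' : GaugeField (F.P p.K) (k + 1) (SU N)) (hχ : chiSeqOfRecord F N ν M g p.K (k + 1) s' V' ≠ 0) :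
    (∏ c : Iχ F ν p g k, chiFactor F N ν p g k c V') = 1 := by
  rw [chiSeqOfRecord_succ_top_eq_prod F N ν M p g k s' hΩ V'] at hχ
  -- an idempotent nonzero real is `1`
  have h3 : (∏ c : Iχ F ν p g k, chiFactor F N ν p g k c V') * ((∏ c : Iχ F ν p g k, chiFactor F N ν p g k c V') - 1) = 0 := by
    rw [mul_sub, mul_one, prod_chiFactor_mul_self F N ν p g k V', sub_self]
  rcases mul_eq_zero.1 h3 with h4 | h4
  · exact (hχ h4).elim
  · linarith

/-- **ON THE `χ_{k+1}`-SUPPORT THE TOP-CHILD WEIGHT IS `b(∅,∅) · Σ_S ζ`**: where `χ_{k+1}(s′)(V′) ≠ 0`,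
`w_k(s′)(U, V′) = χ′_k(ALL cubes)(U, V′) · Σ_S ζ_{k+1}(∅, ∅, (∅, S))(U, V′)`. [cite: Balaban1988Convergent, (3.2)–(3.3) p.265, p.267, (3.25) p.270] -/
theorem wOfRecord_top_eq_of_chiSeq_ne_zero (ζ : ZetaOfRecord F N ν M) (hD : 0 < sideD F ν M p g k) (s' : SeqOfRecord F ν M g p.K (k + 1))
    (hΩ : s'.Ω (k + 1) = Set.univ) (hΛ : s'.Λ (k + 1) = Set.univ) (U : GaugeField (F.P p.K) k (SU N)) (V' : GaugeField (F.P p.K) (k + 1) (SU N))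
    (hχ : chiSeqOfRecord F N ν M g p.K (k + 1) s' V' ≠ 0) :
    wOfRecord F N ν M A₁ ζ p g k s' U V' =
      chiPrime (sect3DataOfRecord F N ν M p g k s'.init) (avOfRecord F N p.K) (2 * deltaOfRecord ν g k A₁) (Finset.univ : Finset (Iχ F ν p g k)) U V' *
        ∑ S : Finset (Iχ F ν p g k), ζ p g k s'.init ∅ ∅ (∅, S) U V' := by
  rw [wOfRecord_top_eq_prod F N ν M A₁ p g k ζ hD s' hΩ hΛ U V', prod_chiFactor_eq_one_of_chiSeq_top_ne_zero F N ν M p g k s' hΩ V' hχ, one_mul]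

/-- **ONE (3.2)-LARGE CUBE KILLS THE TOP CHILD** (for EVERY residual `ζ`): if some χ_{k+1}-cube is (3.2)-large at `V′`, `w_k(s′)(U, V′) = 0` for every `U`.
[cite: Balaban1988Convergent, (3.2) p.265, (3.5) p.265] -/
theorem wOfRecord_top_eq_zero_of_chiFactor_eq_zero (ζ : ZetaOfRecord F N ν M) (hD : 0 < sideD F ν M p g k) (s' : SeqOfRecord F ν M g p.K (k + 1))
    (hΩ : s'.Ω (k + 1) = Set.univ) (hΛ : s'.Λ (k + 1) = Set.univ) (U : GaugeField (F.P p.K) k (SU N)) (V' : GaugeField (F.P p.K) (k + 1) (SU N))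
    {c : Iχ F ν p g k} (hc : chiFactor F N ν p g k c V' = 0) : wOfRecord F N ν M A₁ ζ p g k s' U V' = 0 := by
  rw [wOfRecord_top_eq_prod F N ν M A₁ p g k ζ hD s' hΩ hΛ U V', Finset.prod_eq_zero (Finset.mem_univ c) hc, zero_mul, zero_mul]

/-- **ONE (3.3)-LARGE CUBE KILLS THE TOP CHILD** (for EVERY residual `ζ`): if at some χ_{k+1}-cube the approximate fluctuation `U·(V^{(k)}_{□′})⁻¹` is NOT `2δ_k`-small, then
`w_k(s′)(U, V′) = 0`. [cite: Balaban1988Convergent, (3.3)–(3.4) p.265, (3.5) p.265] -/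
theorem wOfRecord_top_eq_zero_of_not_smallApproxFluct (ζ : ZetaOfRecord F N ν M) (hD : 0 < sideD F ν M p g k) (s' : SeqOfRecord F ν M g p.K (k + 1))
    (hΩ : s'.Ω (k + 1) = Set.univ) (hΛ : s'.Λ (k + 1) = Set.univ) (U : GaugeField (F.P p.K) k (SU N)) (V' : GaugeField (F.P p.K) (k + 1) (SU N))
    {c : Iχ F ν p g k} (hc : ¬ SmallApproxFluct (sect3DataOfRecord F N ν M p g k s'.init) (avOfRecord F N p.K) (2 * deltaOfRecord ν g k A₁) U V' c) :
    wOfRecord F N ν M A₁ ζ p g k s' U V' = 0 := by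
  classical
  have hb : chiPrime (sect3DataOfRecord F N ν M p g k s'.init) (avOfRecord F N p.K) (2 * deltaOfRecord ν g k A₁) (Finset.univ : Finset (Iχ F ν p g k)) U V' = 0 := by
    unfold chiPrime
    exact Finset.prod_eq_zero (Finset.mem_univ c) (by rw [if_neg hc])
  rw [wOfRecord_top_eq_prod F N ν M A₁ p g k ζ hD s' hΩ hΛ U V', hb, mul_zero, zero_mul]

/-- **SIZE**: under the displayed law `Σ_{(R,S)} |ζ| ≤ 1`, `|w_k(s′)(U, V′)| ≤ 1` at the top child (n02-b's `abs_wOfRecord_le_one`, recorded here for the successor's integrability rows).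
[cite: Balaban1988Convergent, (3.2)–(3.3) p.265 (bookkeeping)] -/
theorem abs_wOfRecord_top_le_one {ζ : ZetaOfRecord F N ν M} (hζ : IsZetaAbsLeOne F N ν M ζ) (s' : SeqOfRecord F ν M g p.K (k + 1))
    (U : GaugeField (F.P p.K) k (SU N)) (V' : GaugeField (F.P p.K) (k + 1) (SU N)) : |wOfRecord F N ν M A₁ ζ p g k s' U V'| ≤ 1 :=
  abs_wOfRecord_le_one F N ν M A₁ hζ p g k s' U V'

end ClosedForm

/-! ## §3. The first step `k = 0`: the top pair `(Ω₁, Λ₁) = (𝕋, 𝕋)` — [I] Thm 1 + [II]'s small-field step -/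

section FirstStep

variable (F N) (ν : Stage7Numerics) (M : ℕ) (A₁ : ℝ) (p : B12.RunParams) (g : ℕ → ℝ)

omit [NeZero N] in
/-- **AT THE FIRST STEP EVERY LENGTH-0 HISTORY HAS THE TOP CHILD** (`Z_0 = ∅`: no large-field window): the label `(∅, ∅, (∅, S))` is mapped to the pair `(𝕋, 𝕋)`, and conversely.
[cite: Balaban1988Convergent, (3.5) p.265, (3.20) p.269, p.264] -/
theorem σOfRecord_zero_eq_iff_of_top (hD : 0 < sideD F ν M p g 0) (s₀ : SeqOfRecord F ν M g p.K 0) (s' : SeqOfRecord F ν M g p.K 1)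
    (hs : s'.init = s₀) (hΩ : s'.Ω 1 = Set.univ) (hΛ : s'.Λ 1 = Set.univ) (t : LbOfRecord F ν p g 0) :
    σOfRecord F ν M p g 0 s₀ t = s' ↔ t.1 = ∅ ∧ t.2.1 = ∅ ∧ t.2.2.1 = ∅ :=
  σOfRecord_eq_iff_of_top F ν M p g 0 hD s₀ s' hs hΩ hΛ t

omit [NeZero N] in
/-- At the first step the pair of the label `(∅, ∅, (∅, S))` IS `(𝕋, 𝕋)` (`0 < sideD`). [cite: Balaban1988Convergent, (3.5) p.265, (3.20) p.269] -/
theorem σOfRecord_zero_empty_top (hD : 0 < sideD F ν M p g 0) (s₀ : SeqOfRecord F ν M g p.K 0) (S : Finset (Iχ F ν p g 0)) :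
    (σOfRecord F ν M p g 0 s₀ (∅, ∅, (∅, S))).Ω 1 = Set.univ ∧ (σOfRecord F ν M p g 0 s₀ (∅, ∅, (∅, S))).Λ 1 = Set.univ := by
  refine ⟨?_, ?_⟩
  · rw [σOfRecord_Ω_succ]; exact OmegaOfLabel_empty_empty_eq_univ F ν M p g 0 hD s₀ (fun h => absurd h (by omega)) (∅, S)
  · rw [σOfRecord_Λ_succ]; exact LambdaOfLabel_empty_eq_univ F ν M p g 0 hD s₀ (fun h => absurd h (by omega)) S

/-- ★★ **THE FIRST-STEP WEIGHT OF THE TOP PAIR**: at `s′ = (Ω₁, Λ₁) = (𝕋, 𝕋)`,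
`w_0(s′)(U, V′) = (Π_{□′} χ_{□′}(V′)) · χ′_0(ALL cubes)(U, V′) · Σ_S ζ_1(∅, ∅, (∅, S))(U, V′)` — every χ₁-cube (3.2)-small at the new field `V′` (def-R's localized backgrounds have
all plaquettes `ε₁η₁²`-close to `1`), every cube (3.3)-small (the FINE field `U` is `2δ_0`-close to `V^{(0)}_{□′} = U_{1,□′}(V′)` bondwise on `(□′^{∼2})*`), times the residual's `R = ∅`
marginal: the integrand's weight in [I] Thm 1 + [II]'s first small-field step as def-T renders it. [cite: Balaban1988Convergent, (3.2)–(3.5) p.265, (3.16) p.268, (3.20)–(3.21) p.269, §3 p.267; Balaban1987RG1, Thm 1 p.259] -/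
theorem wOfRecord_zero_top_eq_prod (ζ : ZetaOfRecord F N ν M) (hD : 0 < sideD F ν M p g 0) (s' : SeqOfRecord F ν M g p.K 1)
    (hΩ : s'.Ω 1 = Set.univ) (hΛ : s'.Λ 1 = Set.univ) (U : GaugeField (F.P p.K) 0 (SU N)) (V' : GaugeField (F.P p.K) 1 (SU N)) :
    wOfRecord F N ν M A₁ ζ p g 0 s' U V' =
      (∏ c : Iχ F ν p g 0, chiFactor F N ν p g 0 c V') *
        chiPrime (sect3DataOfRecord F N ν M p g 0 s'.init) (avOfRecord F N p.K) (2 * deltaOfRecord ν g 0 A₁) (Finset.univ : Finset (Iχ F ν p g 0)) U V' *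
          ∑ S : Finset (Iχ F ν p g 0), ζ p g 0 s'.init ∅ ∅ (∅, S) U V' :=
  wOfRecord_top_eq_prod F N ν M A₁ p g 0 ζ hD s' hΩ hΛ U V'

/-- The first-step edition on the `χ₁`-support: `w_0(s′)(U, V′) = χ′_0(ALL cubes)(U, V′) · Σ_S ζ_1(∅, ∅, (∅, S))(U, V′)` wherever `χ₁(s′)(V′) ≠ 0`.
[cite: Balaban1988Convergent, (3.2)–(3.3) p.265, (3.25) p.270; Balaban1987RG1, Thm 1 p.259] -/
theorem wOfRecord_zero_top_eq_of_chiSeq_ne_zero (ζ : ZetaOfRecord F N ν M) (hD : 0 < sideD F ν M p g 0) (s' : SeqOfRecord F ν M g p.K 1)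
    (hΩ : s'.Ω 1 = Set.univ) (hΛ : s'.Λ 1 = Set.univ) (U : GaugeField (F.P p.K) 0 (SU N)) (V' : GaugeField (F.P p.K) 1 (SU N))
    (hχ : chiSeqOfRecord F N ν M g p.K 1 s' V' ≠ 0) :
    wOfRecord F N ν M A₁ ζ p g 0 s' U V' =
      chiPrime (sect3DataOfRecord F N ν M p g 0 s'.init) (avOfRecord F N p.K) (2 * deltaOfRecord ν g 0 A₁) (Finset.univ : Finset (Iχ F ν p g 0)) U V' *
        ∑ S : Finset (Iχ F ν p g 0), ζ p g 0 s'.init ∅ ∅ (∅, S) U V' :=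
  wOfRecord_top_eq_of_chiSeq_ne_zero F N ν M A₁ p g 0 ζ hD s' hΩ hΛ U V' hχ

end FirstStep

end Summit.QuantumFields.YangMills.Theorems.BalabanUVNodesN11TopChildStepWeight

end
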